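import Summits.KontsevichZagierPeriods.KontsevichZagierPeriods.Theorems.TerasomaMultiplicationBetaCancellationOfAyoubPiCancellation

/-!
# Crux stmt-KontsevichZagierPeriods-0540 (`LiouvilleUnfolding.AyoubPiCancellation` ≡ `KZ.PiCancellation`),
# line `Sketch` (idea `moving-segment-wronskian`): stub `stub_bandLift`

Support file (`--supports` stmt-KontsevichZagierPeriods-0540) of the line skeleton, registered stub
`stub_bandLift` (S): the BAND ANALOGUE of the tree theorem `BetaCancellationLine.stub_weightLift`
(`Theorems/TerasomaMultiplicationBetaCancellationStubWeightLift.lean`).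

**Band lift.** Let `a b` be rationals, `w : ℝ → ℝ` a weight of one real variable such that every
representation `r = [t, f]` of dimension `k + 1 ≥ 1` has the weighted companion `[t, w (z 0) · f]`,
let `B` be the pinned BAND family (`B n r` = `{z 0² + z 1² ≤ 1, a < z 0 < b}` in the coordinates
`0, 1` times `r` in the trailing `n` coordinates, integrand `g_r ∘ tail`), let `Bw` be the weighted
band `[{z 0² + z 1² ≤ 1, a < z 0 < b}, w (z 0)]` and let `M : FormalRep →+ FormalRep` be any additive
endomorphism sending the generator `[r]` of a representation of dimension `k + 1` to `[s]` whenever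
`s` is the weighted companion of `r`. Then on the band family the multiplier computes the weighted
band times `c`: `[Bw] * c − M (lift (of ∘ B) c) ∈ relations`.

Proof. Both sides are additive in `c` (`FreeAbelianGroup.induction_on`). On a generator `[t]`
(`t : IntegralRep m`), `M [B m t] = [s]` for the weighted companion `s` of `B m t`, and `s` EQUALS the
reindexed product `(Bw × t).reindex (Fin (2 + m) ≃ Fin (m + 2))` (`KZ.IntegralRep.ext'`: same domain
by the pinning, same integrand since the product integrand is `prodFun` unconditionally,
`KZ.IntegralRep.prod_integrand_eq`); finally `[Bw] * [t] = [Bw × t]` (`KZ.of_mul_of`) differs from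
its reindexing by one rule-(2) move (`KZ.of_sub_of_reindex_mem_relations`).
No definitions; sorry-free; axioms ⊆ {propext, Classical.choice, Quot.sound}.

References: M. Kontsevich, D. Zagier, *Periods* (2001), §1.2 rule (2), §4.1; J. Ayoub, *Une version
relative de la conjecture des périodes de Kontsevich–Zagier*, Ann. of Math. 181 (2015), §1.
-/

noncomputable section

-- `Summit.KontsevichZagierPeriods.KontsevichZagierPeriods.…` is the tree's mandated layout (single-conjunct summit).
set_option linter.dupNamespace false

namespace Summit.KontsevichZagierPeriods.KontsevichZagierPeriods.AyoubPiCancellationLine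

open Set
open Literature.NumberTheory.Transcendental
open Literature.NumberTheory.Transcendental.KZ
open Summit.KontsevichZagierPeriods.KontsevichZagierPeriods.BetaCancellationLine
  (piIndex_castAdd_zero piIndex_castAdd_one piIndex_natAdd)

-- adapted from Summits/KontsevichZagierPeriods/KontsevichZagierPeriods/Theorems/TerasomaMultiplicationBetaCancellationStubWeightLift.lean
-- (disc `piDisc` replaced by the band `{z 0² + z 1² ≤ 1, a < z 0 < b}`; one extra `and_assoc`)

/-! ### The weighted companion of the band family is the reindexed `Bw × t` -/

/-- **The weighted companion of the band family is the reindexed `Bw × t`**: if `s` has the domain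
of `B m t` and integrand `w (z 0) · (B m t).integrand z`, and `Bw` has the band domain
`{z 0² + z 1² ≤ 1, a < z 0 < b}` and integrand `w (z 0)`, then
`s = (Bw × t).reindex (Fin (2 + m) ≃ Fin (m + 2))` (`KZ.IntegralRep.ext'`). [folklore] -/
theorem bandLift_pinned_eq_reindex (a b : ℚ) (w : ℝ → ℝ)
    (B : ∀ n : ℕ, IntegralRep n → IntegralRep (n + 2))
    (hB : ∀ (n : ℕ) (r : IntegralRep n),
      (B n r).domain = {z : Fin (n + 2) → ℝ | z 0 ^ 2 + z 1 ^ 2 ≤ 1 ∧ ((a : ℝ) < z 0 ∧ z 0 < b) ∧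
        (fun i : Fin n => z i.succ.succ) ∈ r.domain} ∧
      (B n r).integrand = fun z => r.integrand (fun i : Fin n => z i.succ.succ))
    {Bw : IntegralRep 2}
    (hBw : Bw.domain = {z : Fin 2 → ℝ | z 0 ^ 2 + z 1 ^ 2 ≤ 1 ∧ ((a : ℝ) < z 0 ∧ z 0 < b)})
    (hBw1 : Bw.integrand = fun z => w (z 0))
    (m : ℕ) (t : IntegralRep m) {s : IntegralRep (m + 2)}
    (hs : s.domain = (B m t).domain)
    (hsi : s.integrand = fun z => w (z 0) * (B m t).integrand z) :
    s = (Bw.prod t).reindex (finCongr (Nat.add_comm 2 m)) := by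
  refine IntegralRep.ext' ?_ ?_
  · rw [hs]
    ext z
    simp only [(hB m t).1, IntegralRep.reindex_domain, IntegralRep.prod_domain,
      IntegralRep.mem_prodDomain, hBw, mem_setOf_eq,
      piIndex_castAdd_zero, piIndex_castAdd_one, piIndex_natAdd, and_assoc]
  · rw [hsi]
    funext z
    simp only [(hB m t).2, IntegralRep.reindex_integrand, IntegralRep.prod_integrand_eq,
      IntegralRep.prodFun, hBw1, piIndex_castAdd_zero, piIndex_natAdd]

/-! ### Band lift: on the band family the multiplier computes `[Bw] * c` -/

/-- STUB `stub_bandLift` (S) of the line `Sketch`: on the pinned BAND family the weight multiplier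
computes the weighted band times `c`: `[band, w(x)] * c − M (lift (of ∘ B) c) ∈ relations` (band
analogue of `BetaCancellationLine.stub_weightLift`: both sides additive in `c`; on a generator `[t]`,
`M [B t]` is the reindexed `[B_w × t] = [B_w] * [t]`, one rule-(2) relabelling
`KZ.of_sub_of_reindex_mem_relations`). [folklore] -/
theorem stub_bandLift : ∀ (a b : ℚ) (w : ℝ → ℝ),
    (∀ (k : ℕ) (r : IntegralRep (k + 1)),
      ∃ s : IntegralRep (k + 1), s.domain = r.domain ∧ s.integrand = fun z => w (z 0) * r.integrand z) →
    ∀ (B : ∀ n : ℕ, IntegralRep n → IntegralRep (n + 2)),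
      (∀ (n : ℕ) (r : IntegralRep n),
        (B n r).domain = {z : Fin (n + 2) → ℝ | z 0 ^ 2 + z 1 ^ 2 ≤ 1 ∧ ((a : ℝ) < z 0 ∧ z 0 < b) ∧
          (fun i : Fin n => z i.succ.succ) ∈ r.domain} ∧
        (B n r).integrand = fun z => r.integrand (fun i : Fin n => z i.succ.succ)) →
    ∀ (Bw : IntegralRep 2), Bw.domain = {z : Fin 2 → ℝ | z 0 ^ 2 + z 1 ^ 2 ≤ 1 ∧ ((a : ℝ) < z 0 ∧ z 0 < b)} →
      (Bw.integrand = fun z => w (z 0)) →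
    ∀ (M : FormalRep →+ FormalRep),
      (∀ (k : ℕ) (r s : IntegralRep (k + 1)), s.domain = r.domain →
          (s.integrand = fun z => w (z 0) * r.integrand z) → M (of r) = of s) →
      ∀ c : FormalRep,
        of Bw * c - M (FreeAbelianGroup.lift (fun s : (Σ n, IntegralRep n) => of (B s.1 s.2)) c) ∈
          relations := by
  intro a b w hex B hB Bw hBw hBw1 M hpin c
  induction c using FreeAbelianGroup.induction_on with
  | zero => simp [relations.zero_mem]
  | of x =>
    obtain ⟨m, t⟩ := x
    rw [FreeAbelianGroup.lift_apply_of]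
    obtain ⟨s, hs, hsi⟩ := hex (m + 1) (B m t)
    change of Bw * of t - M (of (B m t)) ∈ relations
    rw [hpin (m + 1) (B m t) s hs hsi, bandLift_pinned_eq_reindex a b w B hB hBw hBw1 m t hs hsi,
      of_mul_of]
    exact of_sub_of_reindex_mem_relations _ _
  | neg x ih =>
    rw [mul_neg, map_neg, map_neg, ← neg_sub']
    exact relations.neg_mem ih
  | add x y hx hy =>
    rw [mul_add, map_add, map_add, ← sub_add_sub_comm]
    exact relations.add_mem hx hy

end Summit.KontsevichZagierPeriods.KontsevichZagierPeriods.AyoubPiCancellationLine
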